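import Mathlib
import HarnessLib
import Summits.CriticalPhenomena.PercolationContinuityZ3.Theses.PercLowPointHalfSpace
import Summits.CriticalPhenomena.PercolationContinuityZ3.Theorems.QuantitativeBGN.Negative.LoadBearing
import Summits.CriticalPhenomena.PercolationContinuityZ3.Theorems.PercNonProliferationFreeBoxPowerSavingCesaroBlockingGivesOneArm

/-!
# Crux `PercLowPointHalfSpace.QuantitativeBGN` (stmt-CriticalPhenomena-0913) — the half-space blocking criterion

Helper file landed `--supports stmt-CriticalPhenomena-0913` (lead c6). The crux C is a RATE in
Barsky–Grimmett–Newman's `θ_H(p_c) = 0`: `∃ a > 0, C, ∀ r ≥ 1, P_{p_c(ℤ³)}(arm_H(0,r)) ≤ C r^{-a}`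
(`arm_H(0,r)` = the open cluster of `0` in `H = {x₀ ≥ 0}` reaches sup-distance `≥ r`;
`QuantitativeBGN.Negative.armH r`). Every line tried on C dies on a missing SAME-`p`, scale-uniform
input of Russo–Seymour–Welsh type (dossiers `Cruxes/QuantitativeBGN/Lines/*-dead.md`). This file types
the weakest such input that closes C in the tree and proves the closing, for EVERY `p`. Write
`HC_n = {∃ x ∈ Λ_n, ∃ y ∈ ∂ⁱⁿΛ_{2n}, x ↔ y open inside Λ_{2n} ∩ H}` (the annulus `Λ_{2n} ∖ Λ_n` is
crossed inside the HALF-box) and `u^H_n(p) = P_p(¬ HC_n)` (the half-annulus is *blocked*: dually, a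
closed plaquette dome with free boundary on the wall separates `Λ_n ∩ H` from `∂Λ_{2n}` inside `H`).

* `HalfSpaceBlocking.real_armH_le_prod` — **multi-scale product bound** (every `p`, `K`):
  `P_p(arm_H(0, 2^K + 1)) ≤ Π_{j<K} P_p(HC_{2^j})`. The pure events
  `A_j = {ω | ω ∩ (Λ_{2^{j+1}}.sym2 ∖ Λ_{2^j}.sym2) ∈ HC_{2^j}}` are independent (disjoint edge
  classes; `real_biInter_range_eq_prod` of the bulk file `…CesaroBlockingGivesOneArm.lean`), each
  contains `arm_H(0, 2^K+1)` for `j < K` on lattice configurations (`mem_halfCross_inter_of_pathIn`: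
  read the `H`-path from its LAST visit to `Λ_n` to its FIRST subsequent visit to `∂ⁱⁿΛ_{2n}`), and
  `A_j ⊆ HC_{2^j}`. NO decoupling hypothesis is needed for this half-BALL-to-far form of the event.
* `HalfSpaceBlocking.real_armH_le_exp` — `P_p(arm_H(0, 2^K+1)) ≤ exp(-Σ_{j<K} u^H_{2^j}(p))`.
* `HalfSpaceBlocking.quantitativeBGNAt_of_cesaroBlocking` — if eventually
  `c K ≤ Σ_{j<K} u^H_{2^j}(p)` (`c > 0`) then `P_p(arm_H(0,r)) ≤ (2^c + (2^{K₀+1})^c) r^{-c}`, `r ≥ 1`.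
* `quantitativeBGN_of_halfSpaceCesaroBlocking` (registered sub-goal) — at `p = p_c(ℤ³)`: C by name.
* `quantitativeBGN_of_halfAnnulusCrossingBound` (registered sub-goal) — the uniform form:
  `(∃ η > 0, n₀, ∀ n ≥ n₀, P_{p_c}(HC_n) ≤ 1 - η) → QuantitativeBGN` (exponent `a = η/2`).
* `HalfSpaceBlocking.real_not_annulusCrossing_le_real_not_halfCross` — `u_n(p) ≤ u^H_n(p)` (an
  `H`-crossing is a crossing), so the hypothesis is WEAKER than bulk Cesàro blocking
  (`stub_cesaroBlockingGivesOneArm`, route `PercNonProliferation`; `halfSpaceCesaroBlocking_of_bulk`)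
  and than `X_B = CritAnnulusNonCrossing` (route `PercAnnulusCrossing`; cone edges in `…ConeEdges.lean`).

Calibration: the disprover's floor `P_{p_c}(arm_H(0,n+1)) ≥ 1/(588(n+1)²)` and the exponential form
force `Σ_{j<K} u^H_{2^j}(p_c) ≤ 2K log 2 + O(1)` (linear in `K` is the right order); nothing bounds
`u^H_n(p_c)` from BELOW in tree or print (BGN gives only `P_{p_c}(arm_H(0,n)) → 0`): the hypothesis is
the research-open RSW-class statement for the half-space of `ℤ³`, expected true with room.

No definitions, no sorry. Sources: Grimmett, *Percolation* (1999), §1.4, Thm. (7.35) [GrimmettPercolation1999];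
Bollobás–Riordan, *Percolation* (2006), Ch. 3, proof of Thm. 6 (independent annuli) [BollobasRiordan2006].
-/

noncomputable section

namespace Summit.CriticalPhenomena.PercolationContinuityZ3.Theorems

namespace HalfSpaceBlocking

open MeasureTheory Filter
open Literature.Probability.Percolation Literature.Probability.LatticeModels
open Literature.Probability.Percolation.DCT16
open Summit.CriticalPhenomena.PercolationContinuityZ3.Theorems.QuantitativeBGN.Negative
  (armH QuantitativeBGNAt quantitativeBGN_iff zero_mem_H armH_antitone)
open Summit.CriticalPhenomena.PercolationContinuityZ3.FreeBoxPowerSavingLine.CesaroBlockingGivesOneArm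
  (determinedBy_setOf_inter_mem real_biInter_range_eq_prod mem_innerBoundary_box_of_notMem
    openGraph_inter_adj exp_neg_mul_le_two_pow_rpow_neg)
open Summit.CriticalPhenomena.PercolationContinuityZ3.FreeBoxPowerSavingLine.PairGivesOneArm
  (rpow_neg_le_of_le_mul)

/-! ### The half-space annulus crossing event `HC_n` -/

/-- `HC_n` is an increasing event. [folklore] -/
theorem isUpperSet_halfCross (n : ℕ) :
    IsUpperSet {ω : BondConfig (Site 3) | ∃ x ∈ box 3 n,
      ∃ y ∈ innerBoundary (zdGraph 3) (box 3 (2 * n)),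
        ω ∈ openConnIn ((↑(box 3 (2 * n)) : Set (Site 3)) ∩ {x : Site 3 | 0 ≤ x 0}) x y} := by
  rintro ω ω' hle ⟨x, hx, y, hy, hω⟩
  exact ⟨x, hx, y, hy, isUpperSet_openConnIn _ x y hle hω⟩

/-- `HC_n` is measurable (a finite union of connection events inside the finite set `Λ_{2n} ∩ H`).
[folklore] -/
theorem measurableSet_halfCross (n : ℕ) :
    MeasurableSet {ω : BondConfig (Site 3) | ∃ x ∈ box 3 n,
      ∃ y ∈ innerBoundary (zdGraph 3) (box 3 (2 * n)),
        ω ∈ openConnIn ((↑(box 3 (2 * n)) : Set (Site 3)) ∩ {x : Site 3 | 0 ≤ x 0}) x y} := by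
  have h : {ω : BondConfig (Site 3) | ∃ x ∈ box 3 n,
      ∃ y ∈ innerBoundary (zdGraph 3) (box 3 (2 * n)),
        ω ∈ openConnIn ((↑(box 3 (2 * n)) : Set (Site 3)) ∩ {x : Site 3 | 0 ≤ x 0}) x y} =
      ⋃ x ∈ box 3 n, ⋃ y ∈ innerBoundary (zdGraph 3) (box 3 (2 * n)),
        openConnIn ((↑(box 3 (2 * n)) : Set (Site 3)) ∩ {x : Site 3 | 0 ≤ x 0}) x y := by
    ext ω; simp only [Set.mem_setOf_eq, Set.mem_iUnion, exists_prop]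
  rw [h]
  refine Finset.measurableSet_biUnion _ fun x _ => Finset.measurableSet_biUnion _ fun y _ => ?_
  refine (determinedBy_openConnIn _ x y (K := (↑((box 3 (2 * n)).sym2) : Set (Sym2 (Site 3))))
    ?_).measurableSet_of_finset
  rw [Set.sym2_inter, Finset.coe_sym2]
  exact Set.inter_subset_left

/-- `u^H_n(p) = P_p(¬ HC_n) = 1 - P_p(HC_n)`. [folklore] -/
theorem real_not_halfCross_eq (p : unitInterval) (n : ℕ) :
    (bondPercolation (zdGraph 3) p).real
        {ω : BondConfig (Site 3) | ¬ ∃ x ∈ box 3 n,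
          ∃ y ∈ innerBoundary (zdGraph 3) (box 3 (2 * n)),
            ω ∈ openConnIn ((↑(box 3 (2 * n)) : Set (Site 3)) ∩ {x : Site 3 | 0 ≤ x 0}) x y} =
      1 - (bondPercolation (zdGraph 3) p).real
        {ω : BondConfig (Site 3) | ∃ x ∈ box 3 n,
          ∃ y ∈ innerBoundary (zdGraph 3) (box 3 (2 * n)),
            ω ∈ openConnIn ((↑(box 3 (2 * n)) : Set (Site 3)) ∩ {x : Site 3 | 0 ≤ x 0}) x y} :=
  probReal_compl_eq_one_sub (measurableSet_halfCross n)

/-- **Half-space blocking dominates bulk blocking**: an open crossing of `Λ_{2n} ∖ Λ_n` inside the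
half-box `Λ_{2n} ∩ H` is an open crossing inside `Λ_{2n}`, so `P_p(¬ annulusCrossing) ≤ P_p(¬ HC_n)`,
i.e. `u_n(p) ≤ u^H_n(p)`. [folklore] -/
theorem real_not_annulusCrossing_le_real_not_halfCross (p : unitInterval) (n : ℕ) :
    (bondPercolation (zdGraph 3) p).real
        {ω | ¬ ∃ x ∈ box 3 n, ∃ y ∈ innerBoundary (zdGraph 3) (box 3 (2 * n)),
          ω ∈ openConnIn (↑(box 3 (2 * n)) : Set (Site 3)) x y} ≤
      (bondPercolation (zdGraph 3) p).real
        {ω | ¬ ∃ x ∈ box 3 n, ∃ y ∈ innerBoundary (zdGraph 3) (box 3 (2 * n)),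
          ω ∈ openConnIn ((↑(box 3 (2 * n)) : Set (Site 3)) ∩ {x : Site 3 | 0 ≤ x 0}) x y} := by
  refine measureReal_mono fun ω hω h => hω ?_
  obtain ⟨x, hx, y, hy, h⟩ := h
  exact ⟨x, hx, y, hy, openConnIn_mono Set.inter_subset_left x y h⟩

/-! ### Geometry: the pure half-annulus crossing of an `H`-arm -/

/-- **The pure half-annulus crossing of an `H`-arm.** In a lattice configuration `ω ⊆ E(ℤ³)`, an
open path inside `H` from `0` to a point outside `Λ_N` crosses, for `1 ≤ n`, `2n ≤ N`, the annulus
`Λ_{2n} ∖ Λ_n` inside the half-box `Λ_{2n} ∩ H` using only open pairs of scale `n`: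
`ω ∩ (Λ_{2n}.sym2 ∖ Λ_n.sym2) ∈ HC_n`. (From the LAST visit `a` to `Λ_n` to the FIRST subsequent
visit to `∂ⁱⁿΛ_{2n}`, every edge of the path has an endpoint outside `Λ_n` and both endpoints in
`Λ_{2n} ∩ H`.) [folklore] -/
theorem mem_halfCross_inter_of_pathIn {n N : ℕ} (hn : 1 ≤ n) (hN : 2 * n ≤ N)
    {ω : BondConfig (Site 3)} (hω : ω ⊆ (zdGraph 3).edgeSet) {y : Site 3}
    (hy : y ∉ box 3 N) (h : PathIn (openGraph ω) {x : Site 3 | 0 ≤ x 0} 0 y) :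
    ω ∩ ↑((box 3 (2 * n)).sym2 \ (box 3 n).sym2) ∈
      {ω : BondConfig (Site 3) | ∃ x ∈ box 3 n,
        ∃ y ∈ innerBoundary (zdGraph 3) (box 3 (2 * n)),
          ω ∈ openConnIn ((↑(box 3 (2 * n)) : Set (Site 3)) ∩ {x : Site 3 | 0 ≤ x 0}) x y} := by
  obtain ⟨m, hm⟩ : ∃ m : ℕ, m + 1 = 2 * n := ⟨2 * n - 1, by omega⟩
  have hyn : y ∉ (↑(box 3 n) : Set (Site 3)) := fun h' =>
    hy (box_mono 3 (by omega) (Finset.mem_coe.1 h'))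
  have hym : y ∉ (↑(box 3 m) : Set (Site 3)) := fun h' =>
    hy (box_mono 3 (by omega) (Finset.mem_coe.1 h'))
  -- last visit to `Λ_n`
  obtain ⟨a, b, ha, haH, hb, hab, hpath⟩ :=
    h.last_exit (C := (↑(box 3 n) : Set (Site 3))) (Finset.mem_coe.2 (zero_mem_box 3 n)) hyn
  have ha' : a ∈ box 3 n := Finset.mem_coe.1 ha
  have ha2 : a ∈ box 3 (2 * n) := box_mono 3 (by omega) ha'
  have hb2 : b ∈ box 3 (2 * n) :=
    box_mono 3 (by omega) (DCT16.mem_box_succ_of_adj ha' (adj_of_openGraph_adj hω hab))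
  have hbH : b ∈ {x : Site 3 | 0 ≤ x 0} := hpath.left_mem.1
  have hbn : b ∉ box 3 n := fun h' => hb (Finset.mem_coe.2 h')
  have hfirst : PathIn (openGraph (ω ∩ ↑((box 3 (2 * n)).sym2 \ (box 3 n).sym2)))
      ((↑(box 3 (2 * n)) : Set (Site 3)) ∩ {x : Site 3 | 0 ≤ x 0}) a b :=
    PathIn.of_adj ⟨Finset.mem_coe.2 ha2, haH⟩ ⟨Finset.mem_coe.2 hb2, hbH⟩
      (openGraph_inter_adj ha2 hb2 (Or.inr hbn) hab)
  by_cases hbm : b ∈ (↑(box 3 m) : Set (Site 3))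
  · -- first visit to `∂ⁱⁿΛ_{2n}` after `b`: first exit from `Λ_m`, `m + 1 = 2n`
    obtain ⟨a', b', ha'm, hb'm, hb'A, hab', hmid⟩ := hpath.exit hbm hym
    have ha'm' : a' ∈ box 3 m := Finset.mem_coe.1 ha'm
    have ha'2 : a' ∈ box 3 (2 * n) := box_mono 3 (by omega) ha'm'
    have hb'2 : b' ∈ box 3 (2 * n) :=
      hm ▸ DCT16.mem_box_succ_of_adj ha'm' (adj_of_openGraph_adj hω hab')
    have hb'm' : b' ∉ box 3 m := fun h' => hb'm (Finset.mem_coe.2 h')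
    have hmid' : PathIn (openGraph (ω ∩ ↑((box 3 (2 * n)).sym2 \ (box 3 n).sym2)))
        ((↑(box 3 (2 * n)) : Set (Site 3)) ∩ {x : Site 3 | 0 ≤ x 0}) b a' := by
      refine (pathIn_congrGraph (fun u v hu hv huv => openGraph_inter_adj
        (box_mono 3 (by omega) (Finset.mem_coe.1 hu.1))
        (box_mono 3 (by omega) (Finset.mem_coe.1 hv.1))
        (Or.inl fun h' => hu.2.2 (Finset.mem_coe.2 h')) huv) hmid).mono fun z hz => ?_
      exact ⟨Finset.mem_coe.2 (box_mono 3 (by omega) (Finset.mem_coe.1 hz.1)), hz.2.1⟩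
    have ha'n : a' ∉ box 3 n := fun h' => hmid.right_mem.2.2 (Finset.mem_coe.2 h')
    exact ⟨a, ha', b', mem_innerBoundary_box_of_notMem hm hb'2 hb'm',
      mem_openConnIn_of_pathIn ((hfirst.trans hmid').tail
        (openGraph_inter_adj ha'2 hb'2 (Or.inl ha'n) hab') ⟨Finset.mem_coe.2 hb'2, hb'A.1⟩)⟩
  · have hbm' : b ∉ box 3 m := fun h' => hbm (Finset.mem_coe.2 h')
    exact ⟨a, ha', b, mem_innerBoundary_box_of_notMem hm hb2 hbm', mem_openConnIn_of_pathIn hfirst⟩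

/-! ### The multi-scale product bound -/

/-- **Multi-scale product bound for the half-space one-arm** (every `p`, every `K`):
`P_p(arm_H(0, 2^K + 1)) ≤ Π_{j<K} P_p(HC_{2^j})`. [folklore] -/
theorem real_armH_le_prod (p : unitInterval) (K : ℕ) :
    (bondPercolation (zdGraph 3) p).real (armH (2 ^ K + 1)) ≤
      ∏ j ∈ Finset.range K, (bondPercolation (zdGraph 3) p).real
        {ω : BondConfig (Site 3) | ∃ x ∈ box 3 (2 ^ j),
          ∃ y ∈ innerBoundary (zdGraph 3) (box 3 (2 * 2 ^ j)),
            ω ∈ openConnIn ((↑(box 3 (2 * 2 ^ j)) : Set (Site 3)) ∩ {x : Site 3 | 0 ≤ x 0}) x y} := by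
  have hF : Monotone fun j : ℕ => (box 3 (2 ^ j)).sym2 := fun i j hij =>
    Finset.sym2_mono (box_mono 3 (Nat.pow_le_pow_right two_pos hij))
  -- the pure events
  set A : ℕ → Set (BondConfig (Site 3)) := fun j =>
    {ω | ω ∩ ↑((box 3 (2 ^ (j + 1))).sym2 \ (box 3 (2 ^ j)).sym2) ∈
      {ω : BondConfig (Site 3) | ∃ x ∈ box 3 (2 ^ j),
        ∃ y ∈ innerBoundary (zdGraph 3) (box 3 (2 * 2 ^ j)),
          ω ∈ openConnIn ((↑(box 3 (2 * 2 ^ j)) : Set (Site 3)) ∩ {x : Site 3 | 0 ≤ x 0}) x y}} with hA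
  calc (bondPercolation (zdGraph 3) p).real (armH (2 ^ K + 1))
      ≤ (bondPercolation (zdGraph 3) p).real (⋂ j ∈ Finset.range K, A j) := by
        refine real_mono_of_forall_subset_edgeSet (zdGraph 3) p fun ω hω h => ?_
        obtain ⟨y, ⟨i, hi⟩, hconn⟩ := h
        have hpath : PathIn (openGraph ω) {x : Site 3 | 0 ≤ x 0} 0 y :=
          DCT16.mem_openConnIn_iff_pathIn.1 hconn
        have hy : y ∉ box 3 (2 ^ K) := by
          rw [mem_box, not_forall]
          refine ⟨i, fun hb => ?_⟩
          have := abs_le.mpr hb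
          push_cast at hi this
          omega
        refine Set.mem_iInter₂.2 fun j hj => ?_
        have hjK : 2 ^ (j + 1) ≤ 2 ^ K := Nat.pow_le_pow_right two_pos (Finset.mem_range.1 hj)
        simp only [hA, Set.mem_setOf_eq]
        rw [pow_succ'] at hjK ⊢
        exact mem_halfCross_inter_of_pathIn Nat.one_le_two_pow hjK hω hy hpath
    _ = ∏ j ∈ Finset.range K, (bondPercolation (zdGraph 3) p).real (A j) :=
        real_biInter_range_eq_prod (zdGraph 3) p hF (A := A)
          (fun j => by simp only [hA]; exact determinedBy_setOf_inter_mem _ _) K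
    _ ≤ ∏ j ∈ Finset.range K, (bondPercolation (zdGraph 3) p).real
          {ω : BondConfig (Site 3) | ∃ x ∈ box 3 (2 ^ j),
            ∃ y ∈ innerBoundary (zdGraph 3) (box 3 (2 * 2 ^ j)),
              ω ∈ openConnIn ((↑(box 3 (2 * 2 ^ j)) : Set (Site 3)) ∩ {x : Site 3 | 0 ≤ x 0}) x y} :=
        Finset.prod_le_prod (fun _ _ => measureReal_nonneg) fun j _ =>
          measureReal_mono fun ω hω => by
            simp only [hA, Set.mem_setOf_eq] at hω
            exact isUpperSet_halfCross (2 ^ j) Set.inter_subset_left hω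

/-- **Exponential form**: `P_p(arm_H(0, 2^K + 1)) ≤ exp(-Σ_{j<K} u^H_{2^j}(p))`,
`u^H_n(p) = P_p(¬ HC_n) = 1 - P_p(HC_n)`, by `1 - u ≤ e^{-u}`. [folklore] -/
theorem real_armH_le_exp (p : unitInterval) (K : ℕ) :
    (bondPercolation (zdGraph 3) p).real (armH (2 ^ K + 1)) ≤
      Real.exp (-∑ j ∈ Finset.range K, (bondPercolation (zdGraph 3) p).real
        {ω : BondConfig (Site 3) | ¬ ∃ x ∈ box 3 (2 ^ j),
          ∃ y ∈ innerBoundary (zdGraph 3) (box 3 (2 * 2 ^ j)),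
            ω ∈ openConnIn ((↑(box 3 (2 * 2 ^ j)) : Set (Site 3)) ∩ {x : Site 3 | 0 ≤ x 0}) x y}) := by
  calc (bondPercolation (zdGraph 3) p).real (armH (2 ^ K + 1))
      ≤ ∏ j ∈ Finset.range K, (bondPercolation (zdGraph 3) p).real
          {ω : BondConfig (Site 3) | ∃ x ∈ box 3 (2 ^ j),
            ∃ y ∈ innerBoundary (zdGraph 3) (box 3 (2 * 2 ^ j)),
              ω ∈ openConnIn ((↑(box 3 (2 * 2 ^ j)) : Set (Site 3)) ∩ {x : Site 3 | 0 ≤ x 0}) x y} :=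
        real_armH_le_prod p K
    _ ≤ ∏ j ∈ Finset.range K, Real.exp (-(bondPercolation (zdGraph 3) p).real
          {ω : BondConfig (Site 3) | ¬ ∃ x ∈ box 3 (2 ^ j),
            ∃ y ∈ innerBoundary (zdGraph 3) (box 3 (2 * 2 ^ j)),
              ω ∈ openConnIn ((↑(box 3 (2 * 2 ^ j)) : Set (Site 3)) ∩ {x : Site 3 | 0 ≤ x 0}) x y}) := by
        refine Finset.prod_le_prod (fun _ _ => measureReal_nonneg) fun j _ => ?_
        rw [real_not_halfCross_eq p (2 ^ j)]
        have := Real.one_sub_le_exp_neg (1 - (bondPercolation (zdGraph 3) p).real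
          {ω : BondConfig (Site 3) | ∃ x ∈ box 3 (2 ^ j),
            ∃ y ∈ innerBoundary (zdGraph 3) (box 3 (2 * 2 ^ j)),
              ω ∈ openConnIn ((↑(box 3 (2 * 2 ^ j)) : Set (Site 3)) ∩ {x : Site 3 | 0 ≤ x 0}) x y})
        simpa using this
    _ = Real.exp (-∑ j ∈ Finset.range K, (bondPercolation (zdGraph 3) p).real
          {ω : BondConfig (Site 3) | ¬ ∃ x ∈ box 3 (2 ^ j),
            ∃ y ∈ innerBoundary (zdGraph 3) (box 3 (2 * 2 ^ j)),
              ω ∈ openConnIn ((↑(box 3 (2 * 2 ^ j)) : Set (Site 3)) ∩ {x : Site 3 | 0 ≤ x 0}) x y}) := by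
        rw [← Finset.sum_neg_distrib, Real.exp_sum]

/-! ### Analysis: from the dyadic scales to every `r ≥ 1` -/

/-- **Dyadic interpolation for `arm_H`**: `P_p(arm_H(0, 2^K+1)) ≤ e^{-cK}` for `K ≥ K₀` (`0 ≤ c`) gives
`P_p(arm_H(0,r)) ≤ (2^c + (2^{K₀+1})^c) r^{-c}` for `r ≥ 1` (`K = log₂(r-1)`, `arm_H` antitone). [folklore] -/
theorem real_armH_le_of_two_pow (p : unitInterval) {c : ℝ} (hc : 0 ≤ c) {K₀ : ℕ}
    (h : ∀ K : ℕ, K₀ ≤ K →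
      (bondPercolation (zdGraph 3) p).real (armH (2 ^ K + 1)) ≤ Real.exp (-(c * K)))
    {r : ℕ} (hr : 1 ≤ r) :
    (bondPercolation (zdGraph 3) p).real (armH r) ≤
      ((2 : ℝ) ^ c + ((2 : ℝ) ^ (K₀ + 1)) ^ c) * (r : ℝ) ^ (-c) := by
  have hr0 : (0 : ℝ) < r := Nat.cast_pos.2 (Nat.succ_le_iff.1 hr)
  have hrs : 0 ≤ (r : ℝ) ^ (-c) := Real.rpow_nonneg hr0.le _
  have h2c : 0 ≤ (2 : ℝ) ^ c := Real.rpow_nonneg (by norm_num) _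
  have hK₀c : 0 ≤ ((2 : ℝ) ^ (K₀ + 1)) ^ c := Real.rpow_nonneg (by positivity) _
  rcases le_or_gt r (2 ^ (K₀ + 1)) with hsmall | hlarge
  · -- small `r`: `P ≤ 1 ≤ (2^{K₀+1})^c r^{-c}`
    have hrK₀ : (r : ℝ) ≤ (2 : ℝ) ^ (K₀ + 1) * 1 := by
      rw [mul_one]; exact_mod_cast hsmall
    calc (bondPercolation (zdGraph 3) p).real (armH r) ≤ 1 := measureReal_le_one
      _ = (1 : ℝ) ^ (-c) := (Real.one_rpow _).symm
      _ ≤ ((2 : ℝ) ^ (K₀ + 1)) ^ c * (r : ℝ) ^ (-c) :=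
          rpow_neg_le_of_le_mul hc hr0 (by positivity) one_pos hrK₀
      _ ≤ ((2 : ℝ) ^ c + ((2 : ℝ) ^ (K₀ + 1)) ^ c) * (r : ℝ) ^ (-c) :=
          mul_le_mul_of_nonneg_right (le_add_of_nonneg_left h2c) hrs
  · -- large `r`: `K = log₂ (r - 1)`, `2^K + 1 ≤ r ≤ 2 · 2^K`, `K₀ ≤ K`
    set K := Nat.log 2 (r - 1) with hK
    have hr1 : r - 1 ≠ 0 := by
      have : 1 ≤ 2 ^ (K₀ + 1) := Nat.one_le_two_pow
      omega
    have hKr : 2 ^ K ≤ r - 1 := Nat.pow_log_le_self 2 hr1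
    have hrK : r - 1 < 2 ^ (K + 1) := Nat.lt_pow_succ_log_self one_lt_two (r - 1)
    have hK₀K : K₀ ≤ K := by
      have h1 : 2 ^ K₀ ≤ r - 1 := by
        have : 2 ^ (K₀ + 1) = 2 * 2 ^ K₀ := by rw [pow_succ']
        omega
      exact Nat.le_log_of_pow_le one_lt_two h1
    have hmono : (bondPercolation (zdGraph 3) p).real (armH r) ≤
        (bondPercolation (zdGraph 3) p).real (armH (2 ^ K + 1)) :=
      measureReal_mono (armH_antitone (by omega))
    have h2K : (0 : ℝ) < (2 : ℝ) ^ K := by positivity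
    have hr2 : (r : ℝ) ≤ 2 * (2 : ℝ) ^ K := by
      have : r ≤ 2 * 2 ^ K := by rw [← pow_succ']; omega
      exact_mod_cast this
    calc (bondPercolation (zdGraph 3) p).real (armH r)
        ≤ (bondPercolation (zdGraph 3) p).real (armH (2 ^ K + 1)) := hmono
      _ ≤ Real.exp (-(c * K)) := h K hK₀K
      _ ≤ ((2 : ℝ) ^ K) ^ (-c) := exp_neg_mul_le_two_pow_rpow_neg hc K
      _ ≤ (2 : ℝ) ^ c * (r : ℝ) ^ (-c) := rpow_neg_le_of_le_mul hc hr0 two_pos h2K hr2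
      _ ≤ ((2 : ℝ) ^ c + ((2 : ℝ) ^ (K₀ + 1)) ^ c) * (r : ℝ) ^ (-c) :=
          mul_le_mul_of_nonneg_right (le_add_of_nonneg_right hK₀c) hrs

/-- **Half-space Cesàro blocking at `p` gives the crux's bound at `p`** (every `p`): if eventually
`c K ≤ Σ_{j<K} u^H_{2^j}(p)` with `c > 0`, then `P_p(arm_H(0,r)) ≤ C r^{-c}` for all `r ≥ 1`.
[folklore] -/
theorem quantitativeBGNAt_of_cesaroBlocking (p : unitInterval)
    (h : ∃ c : ℝ, 0 < c ∧ ∀ᶠ K : ℕ in atTop, c * (K : ℝ) ≤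
      ∑ j ∈ Finset.range K, (bondPercolation (zdGraph 3) p).real
        {ω : BondConfig (Site 3) | ¬ ∃ x ∈ box 3 (2 ^ j),
          ∃ y ∈ innerBoundary (zdGraph 3) (box 3 (2 * 2 ^ j)),
            ω ∈ openConnIn ((↑(box 3 (2 * 2 ^ j)) : Set (Site 3)) ∩ {x : Site 3 | 0 ≤ x 0}) x y}) :
    QuantitativeBGNAt p := by
  obtain ⟨c, hc, hev⟩ := h
  obtain ⟨K₀, hK₀⟩ := eventually_atTop.1 hev
  refine ⟨c, (2 : ℝ) ^ c + ((2 : ℝ) ^ (K₀ + 1)) ^ c, hc, fun r hr => ?_⟩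
  refine real_armH_le_of_two_pow p hc.le (fun K hK => ?_) hr
  exact (real_armH_le_exp p K).trans (Real.exp_le_exp.2 (neg_le_neg (hK₀ K hK)))

/-- **A uniform half-annulus crossing bound gives Cesàro blocking** (every `p`): if
`P_p(HC_n) ≤ 1 - η` for all `n ≥ n₀` then eventually `(η/2) K ≤ Σ_{j<K} u^H_{2^j}(p)`. [folklore] -/
theorem cesaroBlocking_of_crossingBound (p : unitInterval) {η : ℝ} (hη : 0 < η) {n₀ : ℕ}
    (h : ∀ n : ℕ, n₀ ≤ n → (bondPercolation (zdGraph 3) p).real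
      {ω : BondConfig (Site 3) | ∃ x ∈ box 3 n,
        ∃ y ∈ innerBoundary (zdGraph 3) (box 3 (2 * n)),
          ω ∈ openConnIn ((↑(box 3 (2 * n)) : Set (Site 3)) ∩ {x : Site 3 | 0 ≤ x 0}) x y} ≤ 1 - η) :
    ∃ c : ℝ, 0 < c ∧ ∀ᶠ K : ℕ in atTop, c * (K : ℝ) ≤
      ∑ j ∈ Finset.range K, (bondPercolation (zdGraph 3) p).real
        {ω : BondConfig (Site 3) | ¬ ∃ x ∈ box 3 (2 ^ j),
          ∃ y ∈ innerBoundary (zdGraph 3) (box 3 (2 * 2 ^ j)),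
            ω ∈ openConnIn ((↑(box 3 (2 * 2 ^ j)) : Set (Site 3)) ∩ {x : Site 3 | 0 ≤ x 0}) x y} := by
  refine ⟨η / 2, by positivity, eventually_atTop.2 ⟨2 * n₀, fun K hK => ?_⟩⟩
  -- every scale `j ≥ n₀` (so `2^j ≥ j ≥ n₀`) contributes at least `η`
  have hterm : ∀ j ∈ Finset.Ico n₀ K, η ≤ (bondPercolation (zdGraph 3) p).real
      {ω : BondConfig (Site 3) | ¬ ∃ x ∈ box 3 (2 ^ j),
        ∃ y ∈ innerBoundary (zdGraph 3) (box 3 (2 * 2 ^ j)),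
          ω ∈ openConnIn ((↑(box 3 (2 * 2 ^ j)) : Set (Site 3)) ∩ {x : Site 3 | 0 ≤ x 0}) x y} := by
    intro j hj
    have hj' : n₀ ≤ 2 ^ j := (Finset.mem_Ico.1 hj).1.trans (Nat.lt_two_pow_self).le
    have := h (2 ^ j) hj'
    rw [real_not_halfCross_eq p (2 ^ j)]
    linarith
  have hsub : Finset.Ico n₀ K ⊆ Finset.range K := fun j hj =>
    Finset.mem_range.2 (Finset.mem_Ico.1 hj).2
  calc η / 2 * (K : ℝ) ≤ η * ((K : ℝ) - n₀) := by
        have hK' : (2 * n₀ : ℝ) ≤ K := by exact_mod_cast hK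
        nlinarith
    _ = ∑ _j ∈ Finset.Ico n₀ K, η := by
        rw [Finset.sum_const, Nat.card_Ico, nsmul_eq_mul, Nat.cast_sub (by omega)]
        ring
    _ ≤ ∑ j ∈ Finset.Ico n₀ K, (bondPercolation (zdGraph 3) p).real
          {ω : BondConfig (Site 3) | ¬ ∃ x ∈ box 3 (2 ^ j),
            ∃ y ∈ innerBoundary (zdGraph 3) (box 3 (2 * 2 ^ j)),
              ω ∈ openConnIn ((↑(box 3 (2 * 2 ^ j)) : Set (Site 3)) ∩ {x : Site 3 | 0 ≤ x 0}) x y} :=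
        Finset.sum_le_sum hterm
    _ ≤ ∑ j ∈ Finset.range K, (bondPercolation (zdGraph 3) p).real
          {ω : BondConfig (Site 3) | ¬ ∃ x ∈ box 3 (2 ^ j),
            ∃ y ∈ innerBoundary (zdGraph 3) (box 3 (2 * 2 ^ j)),
              ω ∈ openConnIn ((↑(box 3 (2 * 2 ^ j)) : Set (Site 3)) ∩ {x : Site 3 | 0 ≤ x 0}) x y} :=
        Finset.sum_le_sum_of_subset_of_nonneg hsub fun _ _ _ => measureReal_nonneg

/-- **Bulk Cesàro blocking gives half-space Cesàro blocking** (every `p`), by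
`u_n(p) ≤ u^H_n(p)`. [folklore] -/
theorem halfSpaceCesaroBlocking_of_bulk (p : unitInterval)
    (h : ∃ c : ℝ, 0 < c ∧ ∀ᶠ K : ℕ in atTop, c * (K : ℝ) ≤
      ∑ j ∈ Finset.range K, (bondPercolation (zdGraph 3) p).real
        {ω | ¬ ∃ x ∈ box 3 (2 ^ j), ∃ y ∈ innerBoundary (zdGraph 3) (box 3 (2 * 2 ^ j)),
          ω ∈ openConnIn (↑(box 3 (2 * 2 ^ j)) : Set (Site 3)) x y}) :
    ∃ c : ℝ, 0 < c ∧ ∀ᶠ K : ℕ in atTop, c * (K : ℝ) ≤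
      ∑ j ∈ Finset.range K, (bondPercolation (zdGraph 3) p).real
        {ω : BondConfig (Site 3) | ¬ ∃ x ∈ box 3 (2 ^ j),
          ∃ y ∈ innerBoundary (zdGraph 3) (box 3 (2 * 2 ^ j)),
            ω ∈ openConnIn ((↑(box 3 (2 * 2 ^ j)) : Set (Site 3)) ∩ {x : Site 3 | 0 ≤ x 0}) x y} := by
  obtain ⟨c, hc, hev⟩ := h
  refine ⟨c, hc, hev.mono fun K hK => hK.trans (Finset.sum_le_sum fun j _ => ?_)⟩
  exact real_not_annulusCrossing_le_real_not_halfCross p (2 ^ j)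

end HalfSpaceBlocking

open Literature.Probability.Percolation Literature.Probability.LatticeModels
open Summit.CriticalPhenomena.PercolationContinuityZ3.Theorems.QuantitativeBGN.Negative (quantitativeBGN_iff)

/-- **Registered sub-goal: half-space Cesàro blocking at `p_c(ℤ³)` gives `QuantitativeBGN`.**
With `HC_n = {∃ x ∈ Λ_n, ∃ y ∈ ∂ⁱⁿΛ_{2n}, x ↔ y open inside Λ_{2n} ∩ H}` and
`u^H_n = P_{p_c}(¬ HC_n)`: if eventually `c K ≤ Σ_{j<K} u^H_{2^j}` (`c > 0`) then the crux holds
(exponent `a = c`; `HalfSpaceBlocking.quantitativeBGNAt_of_cesaroBlocking` at `p = p_c`). [folklore] -/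
theorem quantitativeBGN_of_halfSpaceCesaroBlocking : (∃ c : ℝ, 0 < c ∧ ∀ᶠ K : ℕ in Filter.atTop, c * (K : ℝ) ≤ ∑ j ∈ Finset.range K, (Literature.Probability.Percolation.bondPercolation (Literature.Probability.LatticeModels.zdGraph 3) (Literature.Probability.Percolation.criticalProbI 3)).real {ω | ¬ ∃ x ∈ Literature.Probability.LatticeModels.box 3 (2 ^ j), ∃ y ∈ Literature.Probability.LatticeModels.innerBoundary (Literature.Probability.LatticeModels.zdGraph 3) (Literature.Probability.LatticeModels.box 3 (2 * 2 ^ j)), ω ∈ Literature.Probability.Percolation.openConnIn ((↑(Literature.Probability.LatticeModels.box 3 (2 * 2 ^ j)) : Set (Literature.Probability.LatticeModels.Site 3)) ∩ {x : Literature.Probability.LatticeModels.Site 3 | 0 ≤ x 0}) x y}) → Summit.CriticalPhenomena.PercolationContinuityZ3.Theses.PercLowPointHalfSpace.QuantitativeBGN :=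
  fun h => quantitativeBGN_iff.2 (HalfSpaceBlocking.quantitativeBGNAt_of_cesaroBlocking _ h)

/-- **Registered sub-goal: a scale-uniform half-annulus crossing bound at `p_c(ℤ³)` gives
`QuantitativeBGN`.** If `P_{p_c}(HC_n) ≤ 1 - η` for all `n ≥ n₀` (`η > 0`) then the crux holds
(exponent `a = η/2`): `HalfSpaceBlocking.cesaroBlocking_of_crossingBound` then
`quantitativeBGN_of_halfSpaceCesaroBlocking`. [folklore] -/
theorem quantitativeBGN_of_halfAnnulusCrossingBound : (∃ η : ℝ, 0 < η ∧ ∃ n₀ : ℕ, ∀ n : ℕ, n₀ ≤ n → (Literature.Probability.Percolation.bondPercolation (Literature.Probability.LatticeModels.zdGraph 3) (Literature.Probability.Percolation.criticalProbI 3)).real {ω | ∃ x ∈ Literature.Probability.LatticeModels.box 3 n, ∃ y ∈ Literature.Probability.LatticeModels.innerBoundary (Literature.Probability.LatticeModels.zdGraph 3) (Literature.Probability.LatticeModels.box 3 (2 * n)), ω ∈ Literature.Probability.Percolation.openConnIn ((↑(Literature.Probability.LatticeModels.box 3 (2 * n)) : Set (Literature.Probability.LatticeModels.Site 3)) ∩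 {x : Literature.Probability.LatticeModels.Site 3 | 0 ≤ x 0}) x y} ≤ 1 - η) → Summit.CriticalPhenomena.PercolationContinuityZ3.Theses.PercLowPointHalfSpace.QuantitativeBGN :=
  fun ⟨_, hη, _, h⟩ => quantitativeBGN_of_halfSpaceCesaroBlocking
    (HalfSpaceBlocking.cesaroBlocking_of_crossingBound _ hη h)

end Summit.CriticalPhenomena.PercolationContinuityZ3.Theorems

end
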